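import Literature.Geometry.ComplexAnalytic.PhamBrieskornA3QuotientPiece
import Literature.AlgebraicTopology.SingularHomology.PunctureCohomologyField
import Mathlib.Analysis.SpecialFunctions.Pow.Continuity
import Mathlib.Analysis.Normed.Module.Ball.Homeomorph
import Mathlib.Topology.Algebra.Module.FiniteDimension
import HarnessLib

/-!
# Explicit charts of the Milnor fibre `z₀² + z₁² + z₂^p = 1` at the fixed points `(0, ±1, 0)` of `ι` (the graph `z₁ = ±√(1 − z₀² − z₂^p)`),
# and the puncture isomorphism `H²(F; ℚ) ≅ H²(F°; ℚ)` — brick L6-5b: the local piece `F°∕ι` unconditionally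

Family `hodge`, layer `Literature/Geometry/ComplexAnalytic`; sequel of `PhamBrieskornA3QuotientPiece` (the local piece `F°∕ι` of the d6
degeneration, modulo the puncture isomorphism) and of `Literature.AlgebraicTopology.SingularHomology.PunctureCohomologyField` (removing the
centre of an explicit Euclidean cell does not change `Hᵏ(−; ℚ)` in the middle degrees). Written by the prover seat `hodge-nonav-prover-Ax`
(g18), crux K1Q `VeryGeneralQuaternionCommutatorsInHg` (route `Summits/HodgeConjecture/HodgeConjecture/Theses/Q8SymplecticPowers.lean`, stub S5).
Near `P_ε = (0, ε, 0)` (`ε = ±1`) the fibre `F` is the graph of `z₁ = ε √(1 − z₀² − z₂^p)` over a polydisc in `(z₀, z₂)` (implicit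
function theorem for `∂/∂z₁ = 2z₁ ≠ 0`; here explicit through the principal square root, continuous on the slit plane).

* §1 `rootFun`, `chartVec`, `chartSet`, **`chartHomeomorph`** (the unit polydisc of `ℂ²` `≃ₜ` an open neighbourhood of `P_ε` in `F`),
  **`chartEmb`** (`ℝ⁴ ↪ F` an open embedding centred at `P_ε`: `isOpenEmbedding_chartEmb`, `chartEmb_zero`).
* §2 **`bijective_map_punctIncl`** — the restriction `H²(F; ℚ) → H²(F°; ℚ)`, `F° = F ∖ {P₊, P₋}`, is bijective (`p ≥ 1`).
* §3 **`quotientPiece_package_holds`** — the local piece for `p = 4` UNCONDITIONALLY: `dim_ℚ H²(F°∕ι; ℚ) = 2`, `(τ̄^*)² = −1`, and the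
  descended model monodromy acts as `τ̄^*`.

No HC content; no named fact; rung F-H1 not moved.

## References

* [Milnor1968] J. Milnor, Singular Points of Complex Hypersurfaces, §2 (the fibre is a smooth manifold: implicit function theorem), §9.
* [HatcherAT2002] A. Hatcher, Algebraic Topology, CUP 2002, §3.3 p. 231 (removing points from a manifold).
-/

noncomputable section

open Complex ContinuousMap Set CategoryTheory Metric Topology
open Literature.AlgebraicTopology.SingularHomology

namespace Literature.Geometry.ComplexAnalytic

namespace PhamBrieskorn

/-! ### §1 The graph charts at `(0, ±1, 0)` -/

section Charts

variable (p : ℕ)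

/-- `√(1 − (u/2)² − (w/2)^p)` (principal branch), the `z₁`-coordinate of the graph chart. [cite: Milnor1968, §2] -/
def rootFun (q : ℂ × ℂ) : ℂ := (1 - (q.1 / 2) ^ 2 - (q.2 / 2) ^ p) ^ (((2 : ℕ) : ℂ)⁻¹)

/-- On the unit polydisc `‖(u/2)² + (w/2)^p‖ < 1` (`p ≥ 1`). [cite: Milnor1968, §2] -/
theorem norm_sq_add_pow_lt_one (hp : p ≠ 0) {q : ℂ × ℂ} (hq : q ∈ ball (0 : ℂ × ℂ) 1) : ‖(q.1 / 2) ^ 2 + (q.2 / 2) ^ p‖ < 1 := by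
  rw [mem_ball_zero_iff, Prod.norm_def, max_lt_iff] at hq
  have h1 : ‖(q.1 / 2) ^ 2‖ ≤ 1 / 4 := by
    rw [norm_pow, norm_div, Complex.norm_two]
    have : ‖q.1‖ / 2 ≤ 1 / 2 := by linarith [hq.1]
    nlinarith [norm_nonneg q.1]
  have h2 : ‖(q.2 / 2) ^ p‖ ≤ 1 / 2 := by
    rw [norm_pow, norm_div, Complex.norm_two]
    have hle : ‖q.2‖ / 2 ≤ 1 / 2 := by linarith [hq.2]
    have h0 : 0 ≤ ‖q.2‖ / 2 := by positivity
    calc (‖q.2‖ / 2) ^ p ≤ (1 / 2) ^ p := pow_le_pow_left₀ h0 hle p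
      _ ≤ (1 / 2) ^ 1 := pow_le_pow_of_le_one (by norm_num) (by norm_num) (Nat.one_le_iff_ne_zero.2 hp)
      _ = 1 / 2 := pow_one _
  calc ‖(q.1 / 2) ^ 2 + (q.2 / 2) ^ p‖ ≤ ‖(q.1 / 2) ^ 2‖ + ‖(q.2 / 2) ^ p‖ := norm_add_le _ _
    _ ≤ 1 / 4 + 1 / 2 := add_le_add h1 h2
    _ < 1 := by norm_num

/-- The radicand lies in the slit plane on the unit polydisc. [cite: Milnor1968, §2] -/
theorem radicand_mem_slitPlane (hp : p ≠ 0) {q : ℂ × ℂ} (hq : q ∈ ball (0 : ℂ × ℂ) 1) : 1 - (q.1 / 2) ^ 2 - (q.2 / 2) ^ p ∈ slitPlane := by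
  have h : 1 - (q.1 / 2) ^ 2 - (q.2 / 2) ^ p = 1 + -((q.1 / 2) ^ 2 + (q.2 / 2) ^ p) := by ring
  rw [h]
  exact mem_slitPlane_of_norm_lt_one (by rw [norm_neg]; exact norm_sq_add_pow_lt_one p hp hq)

/-- `rootFun² = 1 − (u/2)² − (w/2)^p`. [cite: Milnor1968, §2] -/
theorem rootFun_sq (q : ℂ × ℂ) : rootFun p q ^ 2 = 1 - (q.1 / 2) ^ 2 - (q.2 / 2) ^ p :=
  Complex.cpow_nat_inv_pow _ two_ne_zero

/-- `rootFun ≠ 0` on the unit polydisc. [cite: Milnor1968, §2] -/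
theorem rootFun_ne_zero (hp : p ≠ 0) {q : ℂ × ℂ} (hq : q ∈ ball (0 : ℂ × ℂ) 1) : rootFun p q ≠ 0 := by
  intro h
  have h2 := rootFun_sq p q
  rw [h, zero_pow two_ne_zero] at h2
  exact Complex.slitPlane_ne_zero (radicand_mem_slitPlane p hp hq) h2.symm

/-- `rootFun 0 = 1`. [cite: Milnor1968, §2] -/
theorem rootFun_zero (hp : p ≠ 0) : rootFun p 0 = 1 := by
  simp only [rootFun, Prod.fst_zero, Prod.snd_zero, zero_div, zero_pow two_ne_zero, zero_pow hp, sub_zero]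
  exact Complex.one_cpow _

/-- `rootFun` is continuous at every point of the unit polydisc. [cite: Milnor1968, §2] -/
theorem continuousAt_rootFun (hp : p ≠ 0) {q : ℂ × ℂ} (hq : q ∈ ball (0 : ℂ × ℂ) 1) : ContinuousAt (rootFun p) q := by
  have hc : Continuous fun q : ℂ × ℂ => 1 - (q.1 / 2) ^ 2 - (q.2 / 2) ^ p := by fun_prop
  have h : ContinuousAt ((fun t : ℂ => t ^ (((2 : ℕ) : ℂ)⁻¹)) ∘ fun q : ℂ × ℂ => 1 - (q.1 / 2) ^ 2 - (q.2 / 2) ^ p) q :=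
    ContinuousAt.comp (continuousAt_cpow_const (radicand_mem_slitPlane p hp hq)) hc.continuousAt
  exact h

/-- `rootFun` is continuous on the unit polydisc. [cite: Milnor1968, §2] -/
theorem continuousOn_rootFun (hp : p ≠ 0) : ContinuousOn (rootFun p) (ball (0 : ℂ × ℂ) 1) := fun _ hq =>
  (continuousAt_rootFun p hp hq).continuousWithinAt


/-- The chart vector `(u/2, ε √(1 − (u/2)² − (w/2)^p), w/2)`. [cite: Milnor1968, §2] -/
def chartVec (ε : ℂ) (q : ℂ × ℂ) : Fin (1 + 2) → ℂ := ![q.1 / 2, ε * rootFun p q, q.2 / 2]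

/-- Coordinates of the chart vector. [cite: Milnor1968, §2] -/
theorem chartVec_apply (ε : ℂ) (q : ℂ × ℂ) :
    chartVec p ε q 0 = q.1 / 2 ∧ chartVec p ε q 1 = ε * rootFun p q ∧ chartVec p ε q (Fin.last 2) = q.2 / 2 := ⟨rfl, rfl, rfl⟩


/-- The chart vector lies on the fibre (`ε² = 1`). [cite: Milnor1968, §2] -/
theorem chartVec_mem_fibre (ε : ℂ) (hε : ε ^ 2 = 1) (q : ℂ × ℂ) : chartVec p ε q ∈ fibre (cyclicNodeExponents p) := by
  rw [mem_fibre, Fin.sum_univ_three]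
  have h0 : cyclicNodeExponents p 0 = 2 := rfl
  have h1 : cyclicNodeExponents p 1 = 2 := rfl
  have h2 : cyclicNodeExponents p 2 = p := rfl
  rw [h0, h1, h2]
  change (q.1 / 2) ^ 2 + (ε * rootFun p q) ^ 2 + (q.2 / 2) ^ p = 1
  rw [mul_pow, hε, one_mul, rootFun_sq]
  ring

/-- **The chart neighbourhood `U_ε` of `P_ε`**: the points of `F` over the unit polydisc on the sheet `z₁ = ε √(…)` (cut out by the OPEN
condition `‖z₁ − ε√‖ < ‖√‖`). [cite: Milnor1968, §2] -/
def chartSet (ε : ℂ) : Set (fibre (cyclicNodeExponents p)) :=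
  {z | (2 * (z : Fin (1 + 2) → ℂ) 0, 2 * (z : Fin (1 + 2) → ℂ) (Fin.last 2)) ∈ ball (0 : ℂ × ℂ) 1 ∧
    ‖(z : Fin (1 + 2) → ℂ) 1 - ε * rootFun p (2 * (z : Fin (1 + 2) → ℂ) 0, 2 * (z : Fin (1 + 2) → ℂ) (Fin.last 2))‖ <
      ‖rootFun p (2 * (z : Fin (1 + 2) → ℂ) 0, 2 * (z : Fin (1 + 2) → ℂ) (Fin.last 2))‖}

/-- The projection `z ↦ (2 z₀, 2 z₂)` is continuous. [folklore] -/
private theorem continuous_proj2 :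
    Continuous fun z : fibre (cyclicNodeExponents p) => ((2 * (z : Fin (1 + 2) → ℂ) 0, 2 * (z : Fin (1 + 2) → ℂ) (Fin.last 2)) : ℂ × ℂ) :=
  ((continuous_const.mul ((continuous_apply 0).comp continuous_subtype_val)).prodMk
    (continuous_const.mul ((continuous_apply (Fin.last 2)).comp continuous_subtype_val)))

/-- `U_ε` is open in `F`. [cite: Milnor1968, §2] -/
theorem isOpen_chartSet (hp : p ≠ 0) (ε : ℂ) : IsOpen (chartSet p ε) := by
  let Φ : fibre (cyclicNodeExponents p) → ℂ × ℂ := fun z =>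
    (2 * (z : Fin (1 + 2) → ℂ) 0, 2 * (z : Fin (1 + 2) → ℂ) (Fin.last 2))
  have hΦ : Continuous Φ := continuous_proj2 p
  let f : fibre (cyclicNodeExponents p) → ℂ × ℂ := fun z => ((z : Fin (1 + 2) → ℂ) 1 - ε * rootFun p (Φ z), rootFun p (Φ z))
  have hf : ContinuousOn f (Φ ⁻¹' ball 0 1) := by
    have hr : ContinuousOn (fun z => rootFun p (Φ z)) (Φ ⁻¹' ball 0 1) :=
      (continuousOn_rootFun p hp).comp hΦ.continuousOn fun z hz => hz
    exact ((((continuous_apply 1).comp continuous_subtype_val).continuousOn).sub (continuousOn_const.mul hr)).prodMk hr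
  have ht : IsOpen {ab : ℂ × ℂ | ‖ab.1‖ < ‖ab.2‖} := isOpen_lt (continuous_norm.comp continuous_fst) (continuous_norm.comp continuous_snd)
  exact hf.isOpen_inter_preimage (isOpen_ball.preimage hΦ) ht

/-- On `U_ε` the `z₁`-coordinate IS `ε √(1 − z₀² − z₂^p)`. [cite: Milnor1968, §2] -/
theorem eq_of_mem_chartSet (hp : p ≠ 0) (ε : ℂ) (hε : ε ^ 2 = 1) {z : fibre (cyclicNodeExponents p)} (hz : z ∈ chartSet p ε) :
    (z : Fin (1 + 2) → ℂ) 1 = ε * rootFun p (2 * (z : Fin (1 + 2) → ℂ) 0, 2 * (z : Fin (1 + 2) → ℂ) (Fin.last 2)) := by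
  obtain ⟨hq, hlt⟩ := hz
  set S := rootFun p (2 * (z : Fin (1 + 2) → ℂ) 0, 2 * (z : Fin (1 + 2) → ℂ) (Fin.last 2)) with hS
  -- the fibre equation: `z₁² = S²`
  have hF : (z : Fin (1 + 2) → ℂ) 0 ^ 2 + (z : Fin (1 + 2) → ℂ) 1 ^ 2 + (z : Fin (1 + 2) → ℂ) (Fin.last 2) ^ p = 1 := by
    have h := z.2
    rw [mem_fibre, Fin.sum_univ_three] at h
    exact h
  have hsq : (z : Fin (1 + 2) → ℂ) 1 ^ 2 = S ^ 2 := by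
    rw [hS, rootFun_sq]
    linear_combination hF
  have hprod : ((z : Fin (1 + 2) → ℂ) 1 - ε * S) * ((z : Fin (1 + 2) → ℂ) 1 + ε * S) = 0 := by
    linear_combination hsq - S ^ 2 * hε
  rcases mul_eq_zero.1 hprod with h | h
  · exact sub_eq_zero.1 h
  · exfalso
    have hz1 : (z : Fin (1 + 2) → ℂ) 1 = -(ε * S) := eq_neg_of_add_eq_zero_left h
    rw [hz1, ← neg_add', norm_neg, ← two_mul, norm_mul, Complex.norm_two] at hlt
    have hS0 : 0 < ‖S‖ := norm_pos_iff.2 (rootFun_ne_zero p hp hq)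
    have hεn : ‖ε‖ = 1 := by
      have h := congrArg (‖·‖) hε
      simp only [norm_pow, norm_one] at h
      nlinarith [norm_nonneg ε]
    rw [norm_mul, hεn, one_mul] at hlt
    linarith

/-- **The graph chart**: the unit polydisc of `ℂ²` is homeomorphic to the open neighbourhood `U_ε` of `P_ε` in `F`, by
`(u, w) ↦ (u/2, ε √(1 − (u/2)² − (w/2)^p), w/2)` with inverse `z ↦ (2 z₀, 2 z₂)`. [cite: Milnor1968, §2] -/
def chartHomeomorph (hp : p ≠ 0) (ε : ℂ) (hε : ε ^ 2 = 1) : ↥(ball (0 : ℂ × ℂ) 1) ≃ₜ ↥(chartSet p ε) where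
  toFun q := ⟨⟨chartVec p ε q, chartVec_mem_fibre p ε hε q⟩, by
    refine ⟨?_, ?_⟩
    · change ((2 * (q.1.1 / 2), 2 * (q.1.2 / 2)) : ℂ × ℂ) ∈ ball (0 : ℂ × ℂ) 1
      rw [mul_div_cancel₀ _ (two_ne_zero (α := ℂ)), mul_div_cancel₀ _ (two_ne_zero (α := ℂ))]
      exact q.2
    · change ‖ε * rootFun p q - ε * rootFun p (2 * (q.1.1 / 2), 2 * (q.1.2 / 2))‖ < ‖rootFun p (2 * (q.1.1 / 2), 2 * (q.1.2 / 2))‖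
      rw [mul_div_cancel₀ _ (two_ne_zero (α := ℂ)), mul_div_cancel₀ _ (two_ne_zero (α := ℂ)), Prod.mk.eta, sub_self, norm_zero]
      exact norm_pos_iff.2 (rootFun_ne_zero p hp q.2)⟩
  invFun z := ⟨(2 * ((z : fibre (cyclicNodeExponents p)) : Fin (1 + 2) → ℂ) 0,
    2 * ((z : fibre (cyclicNodeExponents p)) : Fin (1 + 2) → ℂ) (Fin.last 2)), z.2.1⟩
  left_inv q := by
    apply Subtype.ext
    change ((2 * (q.1.1 / 2), 2 * (q.1.2 / 2)) : ℂ × ℂ) = q.1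
    rw [mul_div_cancel₀ _ (two_ne_zero (α := ℂ)), mul_div_cancel₀ _ (two_ne_zero (α := ℂ))]
  right_inv z := by
    apply Subtype.ext; apply Subtype.ext
    funext k
    fin_cases k
    · show 2 * ((z : fibre (cyclicNodeExponents p)) : Fin (1 + 2) → ℂ) 0 / 2 = _
      exact mul_div_cancel_left₀ _ two_ne_zero
    · show ε * rootFun p (2 * ((z : fibre (cyclicNodeExponents p)) : Fin (1 + 2) → ℂ) 0,
        2 * ((z : fibre (cyclicNodeExponents p)) : Fin (1 + 2) → ℂ) (Fin.last 2)) = _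
      exact (eq_of_mem_chartSet p hp ε hε z.2).symm
    · show 2 * ((z : fibre (cyclicNodeExponents p)) : Fin (1 + 2) → ℂ) (Fin.last 2) / 2 = _
      exact mul_div_cancel_left₀ _ two_ne_zero
  continuous_toFun := by
    refine Continuous.subtype_mk (Continuous.subtype_mk ?_ _) _
    refine continuous_pi fun k => ?_
    fin_cases k
    · exact (continuous_fst.comp continuous_subtype_val).div_const _
    · change Continuous fun q : ↥(ball (0 : ℂ × ℂ) 1) => ε * rootFun p q
      exact continuous_const.mul ((continuousOn_rootFun p hp).comp_continuous continuous_subtype_val fun q => q.2)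
    · exact (continuous_snd.comp continuous_subtype_val).div_const _
  continuous_invFun := ((continuous_proj2 p).comp continuous_subtype_val).subtype_mk _

/-- `dim_ℝ ℝ⁴ = dim_ℝ ℂ²` (the real dimension of the model of the chart). [cite: Milnor1968, §2] -/
theorem finrank_euclidean_four_eq : Module.finrank ℝ (EuclideanSpace ℝ (Fin (3 + 1))) = Module.finrank ℝ (ℂ × ℂ) := by
  rw [finrank_euclideanSpace_fin, Module.finrank_prod, Complex.finrank_real_complex]

/-- **The open cell `ℝ⁴ ↪ F` centred at `P_ε`**: `ℝ⁴ ≅ ℂ² ≅ unit polydisc ≅ U_ε ⊆ F`. [cite: Milnor1968, §2] -/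
def chartEmb (hp : p ≠ 0) (ε : ℂ) (hε : ε ^ 2 = 1) : EuclideanSpace ℝ (Fin (3 + 1)) → fibre (cyclicNodeExponents p) :=
  Subtype.val ∘ chartHomeomorph p hp ε hε ∘ Homeomorph.unitBall ∘ (ContinuousLinearEquiv.ofFinrankEq finrank_euclidean_four_eq)

/-- `chartEmb` is an open embedding. [cite: Milnor1968, §2] -/
theorem isOpenEmbedding_chartEmb (hp : p ≠ 0) (ε : ℂ) (hε : ε ^ 2 = 1) : IsOpenEmbedding (chartEmb p hp ε hε) :=
  (((isOpen_chartSet p hp ε).isOpenEmbedding_subtypeVal).comp (chartHomeomorph p hp ε hε).isOpenEmbedding).comp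
    ((Homeomorph.unitBall (E := ℂ × ℂ)).isOpenEmbedding.comp
      (ContinuousLinearEquiv.ofFinrankEq finrank_euclidean_four_eq).toHomeomorph.isOpenEmbedding)

/-- The fixed point `P_ε = (0, ε, 0)` of `ι` on `F` (`ε² = 1`). [cite: CarlsonToledo1999, §6 (held text p0013–p0014)] -/
def fixedPt (ε : ℂ) (hε : ε ^ 2 = 1) : fibre (cyclicNodeExponents p) := ⟨chartVec p ε 0, chartVec_mem_fibre p ε hε 0⟩

/-- Coordinates of `P_ε`: `(0, ε, 0)`. [cite: CarlsonToledo1999, §6 (held text p0013–p0014)] -/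
theorem fixedPt_coe (hp : p ≠ 0) (ε : ℂ) (hε : ε ^ 2 = 1) : ((fixedPt p ε hε : fibre (cyclicNodeExponents p)) : Fin (1 + 2) → ℂ) 0 = 0 ∧
    ((fixedPt p ε hε : fibre (cyclicNodeExponents p)) : Fin (1 + 2) → ℂ) 1 = ε ∧
    ((fixedPt p ε hε : fibre (cyclicNodeExponents p)) : Fin (1 + 2) → ℂ) (Fin.last 2) = 0 := by
  refine ⟨?_, ?_, ?_⟩
  · show (0 : ℂ × ℂ).1 / 2 = 0; simp
  · show ε * rootFun p 0 = ε; rw [rootFun_zero p hp, mul_one]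
  · show (0 : ℂ × ℂ).2 / 2 = 0; simp

/-- `chartEmb 0 = P_ε`. [cite: Milnor1968, §2] -/
theorem chartEmb_zero (hp : p ≠ 0) (ε : ℂ) (hε : ε ^ 2 = 1) : chartEmb p hp ε hε 0 = fixedPt p ε hε := by
  apply Subtype.ext
  change ((chartHomeomorph p hp ε hε (Homeomorph.unitBall ((ContinuousLinearEquiv.ofFinrankEq finrank_euclidean_four_eq) 0)) :
    fibre (cyclicNodeExponents p)) : Fin (1 + 2) → ℂ) = chartVec p ε 0
  rw [map_zero]
  have h0 : ((Homeomorph.unitBall (0 : ℂ × ℂ)) : ℂ × ℂ) = 0 := Homeomorph.coe_unitBall_apply_zero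
  change chartVec p ε ((Homeomorph.unitBall (0 : ℂ × ℂ)) : ℂ × ℂ) = chartVec p ε 0
  rw [h0]

end Charts

/-! ### §2 The puncture isomorphism `H²(F; ℚ) ≅ H²(F°; ℚ)` -/

section Puncture

variable (p : ℕ) (hp : p ≠ 0)

/-- The two fixed points `P₊ = (0, 1, 0)`, `P₋ = (0, −1, 0)` as centres of the two cells. [cite: CarlsonToledo1999, §6 (held text p0013–p0014)] -/
theorem chartEmb_zero_coe (ε : ℂ) (hε : ε ^ 2 = 1) :
    ((chartEmb p hp ε hε 0 : fibre (cyclicNodeExponents p)) : Fin (1 + 2) → ℂ) 0 = 0 ∧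
    ((chartEmb p hp ε hε 0 : fibre (cyclicNodeExponents p)) : Fin (1 + 2) → ℂ) 1 = ε ∧
    ((chartEmb p hp ε hε 0 : fibre (cyclicNodeExponents p)) : Fin (1 + 2) → ℂ) (Fin.last 2) = 0 := by
  rw [chartEmb_zero]; exact fixedPt_coe p hp ε hε

/-- **`F° = F ∖ {P₊, P₋}`**: a point of `F` lies in the punctured fibre iff it is neither centre. [cite: CarlsonToledo1999, §6 (held text p0013–p0014)] -/
theorem mem_punct_iff_ne (z : fibre (cyclicNodeExponents p)) :
    z ∈ punct p ↔ z ≠ chartEmb p hp 1 (by norm_num) 0 ∧ z ≠ chartEmb p hp (-1) (by norm_num) 0 := by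
  obtain ⟨hP0, hP1, hP2⟩ := chartEmb_zero_coe p hp 1 (by norm_num)
  obtain ⟨hM0, hM1, hM2⟩ := chartEmb_zero_coe p hp (-1) (by norm_num)
  constructor
  · intro hz
    refine ⟨fun h => ?_, fun h => ?_⟩
    · rw [h, mem_punct_iff, hP0, hP2] at hz; simp at hz
    · rw [h, mem_punct_iff, hM0, hM2] at hz; simp at hz
  · rintro ⟨h1, h2⟩
    by_contra hz
    rw [mem_punct_iff, not_or, not_ne_iff, not_ne_iff] at hz
    obtain ⟨hz0, hz2⟩ := hz
    -- the fibre equation forces `z₁² = 1`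
    have hF : (z : Fin (1 + 2) → ℂ) 0 ^ 2 + (z : Fin (1 + 2) → ℂ) 1 ^ 2 + (z : Fin (1 + 2) → ℂ) (Fin.last 2) ^ p = 1 := by
      have h := z.2
      rw [mem_fibre, Fin.sum_univ_three] at h
      exact h
    rw [hz0, hz2, zero_pow two_ne_zero, zero_pow hp, zero_add, add_zero, pow_two] at hF
    rcases mul_self_eq_one_iff.1 hF with h | h
    · apply h1
      refine Subtype.ext (funext fun k => ?_)
      fin_cases k
      · exact hz0.trans hP0.symm
      · exact h.trans hP1.symm
      · exact hz2.trans hP2.symm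
    · apply h2
      refine Subtype.ext (funext fun k => ?_)
      fin_cases k
      · exact hz0.trans hM0.symm
      · exact h.trans hM1.symm
      · exact hz2.trans hM2.symm

/-- `P₋ ≠ P₊`. [cite: CarlsonToledo1999, §6 (held text p0013–p0014)] -/
theorem chartEmb_neg_one_zero_ne : chartEmb p hp (-1) (by norm_num) 0 ≠ chartEmb p hp 1 (by norm_num) 0 := by
  intro h
  have h1 := (chartEmb_zero_coe p hp (-1) (by norm_num)).2.1
  rw [h, (chartEmb_zero_coe p hp 1 (by norm_num)).2.1] at h1
  norm_num at h1

/-- The cell at `P₋` misses `P₊` (its points have `z₁ = −√(…)`; at `P₊` this would force `−1 = 1`). [cite: Milnor1968, §2] -/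
theorem chartEmb_neg_one_ne (x : EuclideanSpace ℝ (Fin (3 + 1))) : chartEmb p hp (-1) (by norm_num) x ≠ chartEmb p hp 1 (by norm_num) 0 := by
  intro h
  obtain ⟨hP0, hP1, hP2⟩ := chartEmb_zero_coe p hp 1 (by norm_num)
  -- the point lies in the chart set of `ε = −1`, where `z₁ = −rootFun`; at `P₊`: `(2·0, 2·0) = 0`, `rootFun 0 = 1`
  have hmem : (chartEmb p hp (-1) (by norm_num) x) ∈ chartSet p (-1) :=
    (chartHomeomorph p hp (-1) (by norm_num) _).2
  have heq := eq_of_mem_chartSet p hp (-1) (by norm_num) hmem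
  rw [h, hP0, hP1, hP2, mul_zero] at heq
  change (1 : ℂ) = -1 * rootFun p (0 : ℂ × ℂ) at heq
  rw [rootFun_zero p hp] at heq
  norm_num at heq

/-- **The puncture isomorphism**: the restriction `H²(F; ℚ) → H²(F°; ℚ)` along `F° ↪ F` is bijective (`p ≥ 1`): remove `P₊` then `P₋`, each
the centre of an explicit cell in a Hausdorff space (`map_subsetIncl_compl_singleton_bijective_of_isOpenEmbedding`, degree `2` in real
dimension `4`). [cite: HatcherAT2002, §3.3 p. 231] [cite: Milnor1968, §2] -/
theorem bijective_map_punctIncl (hp : p ≠ 0) : Function.Bijective (singularCohomology.map ℚ ℚ (punctIncl p) 2) := by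
  -- step 1: remove `P₊` from `F`
  set Pp := chartEmb p hp 1 (by norm_num) 0 with hPp
  set S₁ : Set (fibre (cyclicNodeExponents p)) := {Pp}ᶜ with hS₁
  have hb₁ : Function.Bijective (singularCohomology.map ℚ ℚ (subsetIncl S₁) 2) :=
    map_subsetIncl_compl_singleton_bijective_of_isOpenEmbedding ℚ (isOpenEmbedding_chartEmb p hp 1 (by norm_num)) (k := 2)
      le_rfl (by norm_num) (by norm_num)
  -- step 2: remove `P₋` from `↥S₁`
  let i' : EuclideanSpace ℝ (Fin (3 + 1)) → ↥S₁ := fun x => ⟨chartEmb p hp (-1) (by norm_num) x, chartEmb_neg_one_ne p hp x⟩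
  have hi' : IsOpenEmbedding i' :=
    IsOpenEmbedding.of_comp i' isOpen_compl_singleton.isOpenEmbedding_subtypeVal (isOpenEmbedding_chartEmb p hp (-1) (by norm_num))
  have hb₂ : Function.Bijective (singularCohomology.map ℚ ℚ (subsetIncl ({i' 0}ᶜ : Set ↥S₁)) 2) :=
    map_subsetIncl_compl_singleton_bijective_of_isOpenEmbedding ℚ hi' (k := 2) le_rfl (by norm_num) (by norm_num)
  -- the double complement is `F°`
  have hmem : ∀ z : fibre (cyclicNodeExponents p), z ∈ punct p ↔ ∃ h : z ∈ S₁, (⟨z, h⟩ : ↥S₁) ∈ ({i' 0}ᶜ : Set ↥S₁) := by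
    intro z
    rw [mem_punct_iff_ne p hp]
    constructor
    · rintro ⟨h1, h2⟩
      exact ⟨h1, fun h => h2 (congrArg Subtype.val h)⟩
    · rintro ⟨h1, h2⟩
      exact ⟨h1, fun h => h2 (Subtype.ext h)⟩
  let e : ↥(punct p) ≃ₜ ↥(({i' 0}ᶜ : Set ↥S₁)) :=
    { toFun := fun z => ⟨⟨z.1, ((hmem z.1).1 z.2).1⟩, ((hmem z.1).1 z.2).2⟩
      invFun := fun y => ⟨y.1.1, (hmem y.1.1).2 ⟨y.1.2, y.2⟩⟩
      left_inv := fun z => rfl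
      right_inv := fun y => rfl
      continuous_toFun := by fun_prop
      continuous_invFun := by fun_prop }
  have hfac : punctIncl p = (subsetIncl S₁).comp ((subsetIncl ({i' 0}ᶜ : Set ↥S₁)).comp (e : C(↥(punct p), ↥(({i' 0}ᶜ : Set ↥S₁))))) := by
    ext z; rfl
  rw [hfac, singularCohomology.map_comp, singularCohomology.map_comp]
  change Function.Bijective (fun x => singularCohomology.map ℚ ℚ (e : C(↥(punct p), ↥(({i' 0}ᶜ : Set ↥S₁)))) 2
    (singularCohomology.map ℚ ℚ (subsetIncl ({i' 0}ᶜ : Set ↥S₁)) 2 (singularCohomology.map ℚ ℚ (subsetIncl S₁) 2 x)))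
  exact ((forget (ModuleCat ℚ)).mapIso (singularCohomology.mapIso ℚ ℚ e 2)).toEquiv.bijective.comp (hb₂.comp hb₁)

end Puncture

/-! ### §3 The local piece `F°∕ι` for `p = 4`, unconditionally -/

section Four

variable {ζ : ℂ} (hζ : IsPrimitiveRoot ζ 4)

attribute [local instance] OrbitSpace.homeoMulAction

/-- **The local piece of the d6 degeneration (brick L6-5 complete): on `H²(F°∕ι; ℚ)`, `F°∕ι` the free quotient of the punctured Milnor
fibre of `z₀² + z₁² + z₂⁴` by `ι = (−z₀, z₁, −z₂)`: dimension `2`, `(τ̄^*)² = −1` for the descended covering rotation, and the descended model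
monodromy `(negPair ∘ σ_ζ)‾` acts as `τ̄^*`.** [cite: Milnor1968, §9 Thm. 9.1 and p. 77] [cite: CarlsonToledo1999, §6 (kdoublept) (held text p0013–p0014)]
[cite: HatcherAT2002, §3.G Prop. 3G.1 and §3.3 p. 231] -/
theorem quotientPiece_package_holds :
    Module.finrank ℚ (singularCohomology ℚ ℚ (OrbitSpace (iotaPunct 4 four_ne_zero (by decide))) 2) = 2 ∧
    (∀ a : singularCohomology ℚ ℚ (OrbitSpace (iotaPunct 4 four_ne_zero (by decide))) 2,
      singularCohomology.map ℚ ℚ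
          (OrbitSpace.map (rotatePunct 4 four_ne_zero ⟨ζ, hζ.pow_eq_one⟩)
            (commute_rotatePunct_iotaPunct 4 four_ne_zero (by decide) ⟨ζ, hζ.pow_eq_one⟩) :
            C(OrbitSpace (iotaPunct 4 four_ne_zero (by decide)), OrbitSpace (iotaPunct 4 four_ne_zero (by decide)))) 2
        (singularCohomology.map ℚ ℚ
          (OrbitSpace.map (rotatePunct 4 four_ne_zero ⟨ζ, hζ.pow_eq_one⟩)
            (commute_rotatePunct_iotaPunct 4 four_ne_zero (by decide) ⟨ζ, hζ.pow_eq_one⟩) :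
            C(OrbitSpace (iotaPunct 4 four_ne_zero (by decide)), OrbitSpace (iotaPunct 4 four_ne_zero (by decide)))) 2 a) = -a) ∧
    (∀ a : singularCohomology ℚ ℚ (OrbitSpace (iotaPunct 4 four_ne_zero (by decide))) 2,
      singularCohomology.map ℚ ℚ
          (OrbitSpace.map (negPairPunct 4 * rotatePunct 4 four_ne_zero ⟨ζ, hζ.pow_eq_one⟩)
            (commute_modelPunct_iotaPunct 4 four_ne_zero (by decide) ⟨ζ, hζ.pow_eq_one⟩) :
            C(OrbitSpace (iotaPunct 4 four_ne_zero (by decide)), OrbitSpace (iotaPunct 4 four_ne_zero (by decide)))) 2 a =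
      singularCohomology.map ℚ ℚ
          (OrbitSpace.map (rotatePunct 4 four_ne_zero ⟨ζ, hζ.pow_eq_one⟩)
            (commute_rotatePunct_iotaPunct 4 four_ne_zero (by decide) ⟨ζ, hζ.pow_eq_one⟩) :
            C(OrbitSpace (iotaPunct 4 four_ne_zero (by decide)), OrbitSpace (iotaPunct 4 four_ne_zero (by decide)))) 2 a) :=
  quotientPiece_package hζ (bijective_map_punctIncl 4 four_ne_zero)

end Four

end PhamBrieskorn

end Literature.Geometry.ComplexAnalytic

end
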